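import Mathlib
import HarnessLib
import HarnessLib.Audit
import Summits.ABC.Statement
import HarnessLib.Audit.Status.Attr

/-!
Route: FeketeScales

DORMANT since 2026-08-24T01:08:00Z (reconciler: no traction for 6.4 d (last activity item-evidence-added at 2026-08-17T14:52:53Z); parked, not closed — `ledger route dormant route-ABC-FeketeScales --off` to reactivate) — unstaffed, not closed; items shared with open routes are served there. `ledger route dormant <id> --off` reactivates.

Route FeketeScales — realises idea card ABC/ABC/fekete-submultiplicative-extremal ("Fekete for
abc"), in the
model-consistent form asked for by the card's novelty audit.

OBJECT. The extremal height of the abc equation as a function of the radical scale,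
  G(R) := max{ c : a + b = c an abc triple, rad(abc) <= R }   (finite for every R by Mahler / S-unit
finiteness, abc.S25),
equivalently h(t) := log G(e^t). ABC <=> G(R) = R^{1+o(1)}. Every proved pointwise abc bound is a
bound on G
(Stewart–Yu: log G(R) << R^{1/3}(log R)^3, EvertseGyory2015 (4.6.3)); every witness family is a
lower bound
(G(R) >= R/4 from (1, 2^k - 1, 2^k); Stewart–Tijdeman/Bright: G(R) >= R exp(6.5 sqrt(log R)/loglog
R) i.o.).

THESIS X — it suffices to show the conjunction of
 (1) SCALE SUB-MULTIPLICATIVITY (crux, rank 2): there are theta < 1, K, R0 with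
       G(R1 R2) <= K * exp((log R1R2)^theta) * G(R1) * G(R2)   for all R1, R2 >= R0,
     stated G-free (no max needed): every abc triple with rad <= R1R2 has c <= K e^{(log
R1R2)^theta} c1 c2 for SOME abc
     triples (a_i, b_i, c_i) with rad <= R_i. (theta <= 0 is the card's fixed-constant M; theta >
1/2 follows from
     Robert–Stewart–Tenenbaum's Conjecture A, upper half — item SubmultOfRST; it is NOT known to
follow from ABC.)
 (2) SPARSE GOOD SCALES (crux, rank 3): for every delta > 0 there are arbitrarily large R with G(R)
<= R^{1+delta}
     (abc along SOME unbounded sequence of radical scales; implied by ABC, asserts nothing between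
good scales).
ASSEMBLY (1) -> (2) -> ABC is a Fekete-type iteration (elementary, provable now): from one good
scale R* the
sub-multiplicativity propagates the exponent 1+delta to every scale R*^N with summable loss
(log K / log R* + (log R*)^{theta-1}/(2^{1-theta}-1) -> 0), binary digits of N handle general
scales, monotonicity of G
the rest; (2) also makes G finite everywhere, so the Assembly needs no S-unit theorem.

X as a one-line Lean Prop (item Target; constants
Literature.NumberTheory.DiophantineGeometry.IsABCTriple / .rad, root ABC):
(∃ θ : ℝ, θ < 1 ∧ ∃ K : ℝ, 0 < K ∧ ∃ R₀ : ℕ, ∀ R₁ R₂ : ℕ, R₀ ≤ R₁ → R₀ ≤ R₂ → ∀ a b c : ℕ,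
IsABCTriple a b c → rad a b c ≤ R₁ * R₂ → ∃ a₁ b₁ c₁ a₂ b₂ c₂ : ℕ, IsABCTriple a₁ b₁ c₁ ∧ rad a₁ b₁
c₁ ≤ R₁ ∧ IsABCTriple a₂ b₂ c₂ ∧ rad a₂ b₂ c₂ ≤ R₂ ∧ (c : ℝ) ≤ K * Real.exp (Real.log ((R₁ : ℝ) *
R₂) ^ θ) * c₁ * c₂) ∧ (∀ δ : ℝ, 0 < δ → ∀ N : ℕ, ∃ R : ℕ, N ≤ R ∧ ∀ a b c : ℕ, IsABCTriple a b c →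
rad a b c ≤ R → (c : ℝ) ≤ (R : ℝ) ^ (1 + δ))

Rationale: WHY THIS LINE. It trades "an inequality for every triple" for ONE convexity-type property of ONE
monotone function of the
radical scale (sub-multiplicativity of the record height G, the move that works for percolation
constants, Shannon capacity,
growth of groups) plus abc at a SPARSE set of scales; Fekete-type iteration does the rest. Imported:
subadditivity/Fekete
(Mathlib `Subadditive`), the Robert–Stewart–Tenenbaum record model (RobertStewartTenenbaum2014)
which fixes the admissible
slack, and the complete finite tables (VonkanelMatschke2023 §3.3: ALL abc triples with rad <= 10^7;
deWeger2026: records to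
2^63) on which the crux's constant K(R0, theta) is exactly measurable. Versus the card: the
fixed-constant hypothesis M
(theta <= 0), which the novelty audit showed to be finer than RST's own fluctuation band
(+-sqrt(L)/(log L)^{3/2}) and hence
a bet AGAINST the model, is replaced by the sub-power slack exp((log R)^theta), theta < 1 — the
weakest clean slack for which
the Fekete upgrade from sparse good scales still goes through (summable loss), and which IS implied
by RST Conj. A (item
SubmultOfRST). Logical position: RSTConjectureAUpper => crux 1; ABC => crux 2; crux 1 & crux 2 =>
ABC; crux 1 alone =>
polynomial abc (item PolynomialAbcOfSubmult, via abc.S25); the epsilon-slack form (an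
ABC-consequence) alone => quasi-
polynomial abc log c <= (C + eps loglog rad) log rad (item QuasiPolynomialAbcOfEpsSubmult, the
audit's "honest core").
RANKED CRUXES. #2 ScaleSubmultiplicativity — the structural bet; hardest and most informative (any
proof is polynomial abc;
any measured growth of K(R0, theta) on the rad <= 10^7 table is evidence either way). #3
SparseGoodScales — abc along some
sequence of scales; weaker than ABC only in the quantifier, no certification method known beyond
exhaustive S-unit
resolution (10^7), earns its place through the Assembly. SUPPORT (provable now): Assembly,
SubmultOfRST,
PolynomialAbcOfSubmult, QuasiPolynomialAbcOfEpsSubmult (all elementary real analysis over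
IsABCTriple/rad; 200-600 lines each).
KILL CRITERIA. (a) a theorem "not ScaleSubmultiplicativity" (an incompressible record family: defect
at scale R1R2 exceeding
the best defects at R1, R2 by more than (log R1R2)^theta for every theta < 1) closes the route
refuted; (b) evidence: on D1
(rad <= 10^7) the measured log K(R0, theta)/ (log 10^7)^theta not decreasing in R0 for theta = 1/2,
3/4 => route dormant;
(c) a proof that crux 1 follows from ABC with arbitrary C(eps) would make X a restatement => close
as vacuous/superseded.
NOT DECOMPOSED YET. The explicit finite-table corollary (card F2: theta <= 0, K < 360 on D1 =>
WeakABC c < rad^2) needs D1 as a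
certified computational fact — evidence task for refuters (kit), not an item; the
depth-concentration census (card E2); Lucas/
power-orbit sub-multiplicativity lemmas (card K3) ride later with --supports; no split of either
crux before one closes.
NOVELTY. Searched (card + audit 2026-08-15 + this session: lit search --hybrid "submultiplicative
extremal … S-unit largest
solution", lit vsearch of the thesis sentence, lit galaxy "subadditive abc conjecture radical"
--star all (0), frontier/bridges
ABC): nearest prior art LagariasSoundararajan2011 (extremal-function view of the abc equation,
smoothness not radical),
ErdosStewartTijdeman1988 (lower-bound side of G), RobertStewartTenenbaum2014 (record model, no
scale-to-scale statement),
VonkanelMatschke2023/deWeger2026 (tables), EvertseGyory2015 §4.6 (pointwise bounds = upper bounds on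
G). Not found anywhere:
G as an object, a sub-multiplicativity hypothesis across radical scales, or the Fekete reduction
"sparse good scales + M =>
ABC". Delta vs the card: model-consistent slack, G-free Lean statements, RST => crux proved
direction, S-unit-free Assembly.
BARRIERS. EpsilonCannotBeDropped: respected — every conclusion keeps epsilon (ABC, rad^A,
quasi-poly); the slack is on RATIOS
G(R1R2)/G(R1)G(R2), consistent with Stewart–Tijdeman/Bright lower families for every theta in [0,1).
ExplicitABCQualityFloor:
engaged — Reyssat forces delta >= 0.63 at all certified scales, recorded in crux 2's why-might-fail.
BakerMethodBounds: not this
route's method; Stewart–Yu is the benchmark the conditional corollaries beat. Negatives index: 0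
refuted (2026-08-15).

Novelty: Searched: card author + refuter audit 12 (2026-08-15: lit --hybrid, galaxy, zbMATH, arXiv 'abc
conjecture subadditive Fekete' = 0) + this planner (lit search --hybrid "submultiplicative extremal
function abc radical largest solution S-unit" -> EvertseGyory2015 §4.6 p.88 = pointwise bounds on c
as a function of rad, i.e. upper bounds on G; vsearch: nothing; lit galaxy search "subadditive abc
conjecture radical" --star all = 0; lit frontier ABC -> arXiv:2606.08416: other quality metrics, no
scale coupling). Nearest prior art: LagariasSoundararajan2011 (arXiv:0911.4147; extremal-function
view of the abc equation for SMOOTHNESS, not radical scale), ErdosStewartTijdeman1988 /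
StewartTijdeman1986 / Bright2024 (lower-bound side of G), RobertStewartTenenbaum2014 (record model
per scale, no scale-to-scale statement), VonkanelMatschke2023 §3.3 (= arXiv:1605.06079: all abc
triples with rad <= 10^7) and deWeger2026 (tables), Mathlib Subadditive.tendsto_lim (Fekete). Delta:
G(R) = max{c : rad(abc) <= R} as the object, its sub-multiplicativity across radical scales up to
exp((log R)^theta), and the reduction "sparse good scales + sub-multiplicativity => ABC" appear
nowhere; vs the card: fixed constant (predicted false by RST's fluctuation band) replaced by the
weakest slack the Fekete upgrade tolerates, RSTConjectureAUpper => crux filed as a provable support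
item, G-free statements so the Assembly needs no S-unit theorem. Claimed: new-combination; no proof
mechanism for the crux claimed.  [refs: 2606.08416, 0911.4147, 1605.06079, EvertseGyory2015, LagariasSoundararajan2011, ErdosStewartTijdeman1988, StewartTijdeman1986, Bright2024, RobertStewartTenenbaum2014, VonkanelMatschke2023]

Barriers (technique_class: extremal-function-subadditivity fekete-scale-coupling): technique_class: extremal-function-subadditivity fekete-scale-coupling
- Literature.Barriers.ABC.EpsilonCannotBeDropped: respected, not met — every conclusion keeps a loss
beyond polylog (ABC with epsilon; c <= C rad^A; log c <= (C + eps loglog rad) log rad); the crux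
bounds only RATIOS G(R1R2)/(G(R1)G(R2)) and holds on the Stewart–Tijdeman/van Frankenhuysen/Bright
witness families for every theta in [0,1) (excess exp(6.6 sqrt(log R)/loglog R) is
sub-multiplicative in the scale); RSTConjectureAUpper, marked NOT blocked in that file, implies the
crux (item SubmultOfRST).
- Literature.Barriers.ABC.ExplicitABCQualityFloor: engaged — Reyssat's quality 1.6299 (rad 15042)
makes no certified scale 'good' for delta < 0.6299; this is crux SparseGoodScales' why-might-fail
and the base exponent of the card's finite-table corollary; no explicit exponent <= 1.6299 is
claimed anywhere.
- Literature.Barriers.ABC.BakerMethodBounds: not this route's technique (no linear forms in logs);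
Stewart–Yu log c << rad^{1/3}(log rad)^3 is only the benchmark the conditional corollaries would
supersede.
- HallExponentSharp, MasonStothersFailsInCharP, NoArithmeticDerivative, NConjectureExponentSharp,
IUTDisputedClaim, Szpiro/Uniform entries: not engaged. Negatives index ABC: 0 refuted (2026-08-15).

Novelty grade: new-combination — ROUTE REVIEW (refuter 3bae3c4d, 2026-08-15). All 7 decls rc0; read-back clean (rpow bases ≥ 0; θ < 1 free below; R₀ ≥ 2 prover's choice; 2161 bounds c by the scale; logIter ≥ 1 by definition so the rstExponent estimate holds). Grade new-combination as claimed: Fekete/sub-additivity × RST record mode (refuter refuter-rreview-route-ABC-RadicalCensus--3bae3c4d-0, 2026-08-15T13:47:19Z; prior: RobertStewartTenenbaum2014 Conj. A (record model per scale; RST-A upper ⇒ crux 2160, in tree via SubmultOfRST), LagariasSoundararajan2011 arXiv:0911.4147 (extremal-function view by smoothness, not radical scale), ErdosStewartTijdeman1988 / StewartTijdeman1986 / Bright2024 (lower side of G), VonkanelMatschke2023 arXiv:1605.06079 §3.3; deWeger2026 (complete tables rad ≤ 10^7), Mathlib Subadditive.te)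

History (route lifecycle, newest last):
- 2026-08-15T16:11:06Z · rev 3: restated SubmultOfRST (stmt-ABC-2162) — cone repair (rrepair-ABC-FeketeScales g2): restate support item SubmultOfRST with the RST-type sub-power slack INLINED, so the route no longer names Literature. (planner-rrepair-ABC-FeketeScales-95041bca-g2-0)
- 2026-08-16T03:41:21Z · AUTO-CRUX (backfill): Target — hypotheses of the deciding theorem that nothing in the route derives are cruxes (operator:999:586464)
- 2026-08-24T01:08:00Z · DORMANT — reconciler: no traction for 6.4 d (last activity item-evidence-added at 2026-08-17T14:52:53Z); parked, not closed — `ledger route dormant route-ABC-FeketeScales (operator:999:465084)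

sub-problem: ABC · status: dormant · opened planner-plancard-ABC-ABC-fekete-submultiplica-711a04ca-0 2026-08-15T11:01:26Z · rev 4 · ledger route-ABC-FeketeScales
GENERATED by the gate from the ledger (D-0016/17). Provers cite these decls: `theorem foo : Summit.ABC.ABC.Theses.FeketeScales.<Decl> := …` in Summits/ABC/ABC/Theorems/<Name>.lean.
-/

namespace Summit.ABC.ABC.Theses.FeketeScales

open scoped BigOperators Topology Manifold Classical MeasureTheory ProbabilityTheory Matrix InnerProductSpace ComplexConjugate ContinuousMap
open Filter Set Function TopologicalSpace MeasureTheory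

attribute [summit_statement] _root_.ABC

open Literature.Abc

/-- item stmt-ABC-2159 · crux (kind.auto-crux: conjecture-grade) · rank 0 · open · by planner
why it might fail: Conjunction of the cruxes: (1) bets on sub-multiplicative (regular) growth of record heights across radical scales — implied by RST Conj. A upper half, not by ABC, refutable by a bursty record family; (2) is ABC's liminf-in-scale shadow, uncertifiable beyond rad ≤ 10^7. Either failing kills X.
sources: RobertStewartTenenbaum2014, VonkanelMatschke2023, StewartYu2001, LagariasSoundararajan2011
[target] Thesis X of route FeketeScales (idea card fekete-submultiplicative-extremal,
model-consistent form): the conjunction of the two cruxes, written out — (1) SCALE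
SUB-MULTIPLICATIVITY of the extremal height G(R) := max{c : a+b=c abc triple, rad(abc) <= R}:
G(R1R2) <= K exp((log R1R2)^theta) G(R1) G(R2) for some theta < 1, K > 0 and all R1, R2 >= R0,
stated G-free (every triple at scale R1R2 is dominated by K*slack*c1*c2 for SOME triples at scales
R1, R2); and (2) SPARSE GOOD SCALES: for every delta > 0 there are arbitrarily large R with c <=
R^{1+delta} for every triple with rad(abc) <= R. Definitionally `ScaleSubmultiplicativity ∧
SparseGoodScales` (inlined because the target is rendered before the cruxes). Sources:
RobertStewartTenenbaum2014, VonkanelMatschke2023, LagariasSoundararajan2011. -/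
@[route_item "route-ABC-FeketeScales", crux]
def Target : Prop :=
  (∃ θ : ℝ, θ < 1 ∧ ∃ K : ℝ, 0 < K ∧ ∃ R₀ : ℕ, ∀ R₁ R₂ : ℕ, R₀ ≤ R₁ → R₀ ≤ R₂ → ∀ a b c : ℕ, Literature.NumberTheory.DiophantineGeometry.IsABCTriple a b c → Literature.NumberTheory.DiophantineGeometry.rad a b c ≤ R₁ * R₂ → ∃ a₁ b₁ c₁ a₂ b₂ c₂ : ℕ, Literature.NumberTheory.DiophantineGeometry.IsABCTriple a₁ b₁ c₁ ∧ Literature.NumberTheory.DiophantineGeometry.rad a₁ b₁ c₁ ≤ R₁ ∧ Literature.NumberTheory.DiophantineGeometry.IsABCTriple a₂ b₂ c₂ ∧ Literature.NumberTheory.DiophantineGeometry.rad a₂ b₂ c₂ ≤ R₂ ∧ (c : ℝ) ≤ K * Real.exp (Real.log ((R₁ : ℝ) * R₂) ^ θ) * c₁ * c₂) ∧ (∀ δ : ℝ, 0 < δ → ∀ N : ℕ, ∃ R : ℕ, N ≤ R ∧ ∀ a b c : ℕ, Literature.NumberTheory.DiophantineGeometry.IsABCTriple a b c → Literature.NumberTheory.DiophantineGeometry.rad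 a b c ≤ R → (c : ℝ) ≤ (R : ℝ) ^ (1 + δ))

/-- item stmt-ABC-2160 · crux · rank 2 · open · by planner
why it might fail: False iff record heights are incompressible across scales: excess log(c/rad) ≥ (log rad)^θ for every θ<1, in bursts — allowed by ABC (C(ε) uncontrolled), excluded only by the heuristic RST Conj. A; and any proof yields polynomial abc c ≤ C·rad^A, open (proved: log c ≪ rad^{1/3}(log rad)^3).
sources: RobertStewartTenenbaum2014, StewartYu2001, Bright2024, VonkanelMatschke2023, deWeger2026, Literature.Barriers.ABC.RSTConjectureAUpper
[crux] SCALE SUB-MULTIPLICATIVITY of the abc extremal height (card K1, model-consistent form). With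
G(R) := max{c : (a,b,c) abc triple, rad(abc) <= R} (finite by abc.S25; G(R) >= R/4 via (1, 2^k-1,
2^k)): there are theta < 1, K > 0, R0 with G(R1R2) <= K exp((log R1R2)^theta) G(R1) G(R2) for all
R1, R2 >= R0 — stated G-free (no max needed): every abc triple with rad <= R1*R2 has c <= K e^{(log
R1R2)^theta} c1 c2 for SOME abc triples (a_i,b_i,c_i) with rad <= R_i. theta <= 0 is the card's
fixed-constant M; theta = 3/4 follows from Robert–Stewart–Tenenbaum Conj. A upper half (item
SubmultOfRST), so this form is implied by the standard refined conjecture (the audit's caveat), yet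
NOT known to follow from ABC (needs growth control of C(eps)). Alone + abc.S25 it gives polynomial
abc (item PolynomialAbcOfSubmult). TESTABLE: K(R0, theta) := max over R0 <= R1 <= R2, R1R2 <= 10^7
of G(R1R2)/(e^{(log R1R2)^theta} G(R1) G(R2)) is exactly computable from von Känel–Matschke's D1
(all triples with rad <= 10^7, VonkanelMatschke2023 §3.3); its trend in R0 is the informative output
(card E1(b)); G(14)=G(15)=9 < G(210) forces R0. Src: RST2014, StewartYu2001, EvertseGyory2015
(4.6.3), deWeger2026. -/
@[route_item "route-ABC-FeketeScales", crux]
def ScaleSubmultiplicativity : Prop :=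
  ∃ θ : ℝ, θ < 1 ∧ ∃ K : ℝ, 0 < K ∧ ∃ R₀ : ℕ, ∀ R₁ R₂ : ℕ, R₀ ≤ R₁ → R₀ ≤ R₂ → ∀ a b c : ℕ, Literature.NumberTheory.DiophantineGeometry.IsABCTriple a b c → Literature.NumberTheory.DiophantineGeometry.rad a b c ≤ R₁ * R₂ → ∃ a₁ b₁ c₁ a₂ b₂ c₂ : ℕ, Literature.NumberTheory.DiophantineGeometry.IsABCTriple a₁ b₁ c₁ ∧ Literature.NumberTheory.DiophantineGeometry.rad a₁ b₁ c₁ ≤ R₁ ∧ Literature.NumberTheory.DiophantineGeometry.IsABCTriple a₂ b₂ c₂ ∧ Literature.NumberTheory.DiophantineGeometry.rad a₂ b₂ c₂ ≤ R₂ ∧ (c : ℝ) ≤ K * Real.exp (Real.log ((R₁ : ℝ) * R₂) ^ θ) * c₁ * c₂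

/-- item stmt-ABC-2161 · crux · rank 3 · open · by planner
why it might fail: Says liminf log G(R)/log R ≤ 1: false only if abc fails at EVERY large scale (a triple with rad ≤ X, c ≥ X^{1+δ₀}, all X ≥ X₀); no method certifies one good scale — complete tables end at rad ≤ 10^7 (vKM), exceptional-set counts O(N^{33/50}) never give emptiness, Stewart–Yu: log G ≪ R^{1/3}(log R)³.
sources: VonkanelMatschke2023, Lichtman2025, StewartYu2001, Nitaj1996, Literature.Barriers.ABC.ExplicitABCQualityFloor
[crux] SPARSE GOOD SCALES (card K2 = W, 'abc along SOME unbounded sequence of radical scales'): for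
every delta > 0 and every N there is R >= N such that every abc triple with rad(abc) <= R has c <=
R^{1+delta} — i.e. liminf_R log G(R)/log R <= 1. Implied by ABC (any large R works) and strictly
weaker in form: nothing is asserted between good scales, so by itself it gives no uniform bound
whatsoever; it is exactly the seed that the Fekete-type iteration of ScaleSubmultiplicativity
propagates to all scales (Assembly), and it makes G finite below each good scale for free (the
Assembly needs no S-unit theorem). Data: by VonkanelMatschke2023 §3.3 (all triples with rad <= 10^7;
Baker's explicit conjecture verified there, hence c < rad^{7/4}) every R <= 10^7 is good for delta =
3/4, while Reyssat's 2 + 3^10*109 = 23^5 (rad 15042, quality 1.6299;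
Literature.Barriers.ABC.ExplicitABCQualityFloor, Nitaj1996) makes no certified scale good for delta
< 0.6299. Natural attack if any: density/counting engines (Lichtman2025-type exceptional-set bounds)
sharpened to emptiness at SOME scale — no such upgrade is known. Sources: VonkanelMatschke2023,
Nitaj1996, Lichtman2025, EvertseGyory2015 §4.6. -/
@[route_item "route-ABC-FeketeScales", crux]
def SparseGoodScales : Prop :=
  ∀ δ : ℝ, 0 < δ → ∀ N : ℕ, ∃ R : ℕ, N ≤ R ∧ ∀ a b c : ℕ, Literature.NumberTheory.DiophantineGeometry.IsABCTriple a b c → Literature.NumberTheory.DiophantineGeometry.rad a b c ≤ R → (c : ℝ) ≤ (R : ℝ) ^ (1 + δ)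

-- earlier SubmultOfRST (stmt-ABC-2162, replaced 2026-08-15T16:11:06Z -> stmt-ABC-10340): retired by None — Literature.Barriers.ABC.RSTConjectureAUpper → ScaleSubmultiplicativity
/-- item stmt-ABC-10340 · support · rank 9 · closed · proved by Summit.ABC.ABC.Theorems.submultOfRST_proof (prover) · by planner
[support] MODEL-CONSISTENCY of the rank-2 crux, cone-clean form (provable now, elementary real
analysis; cone repair 2026-08-15). POINTWISE SUB-POWER SLACK => SCALE SUB-MULTIPLICATIVITY: if for
some tau < 1 and some real A every abc triple satisfies c < rad(abc) * exp(A * (log rad)^tau), then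
ScaleSubmultiplicativity holds (theta := (1 + max(tau,0))/2 < 1, K := 16 e^{A+ (log 2)^tau} or 16,
R0 large; prover's choice). The hypothesis is written INLINE on purpose: it is implied by
Robert-Stewart-Tenenbaum's Conjecture A, upper half (1.5) (the named open conjecture
Literature.Barriers.ABC.RSTConjectureAUpper: c < k exp(rstExponent C1 k), k = rad; since logIter j k
>= 1 and logIter 3 k <= logIter 2 k, rstExponent C1 k <= 4 sqrt 3 (3/2 + |C1|) (log k)^{1/2} for
every k >= 2, i.e. tau = 1/2, A = 4 sqrt 3 (3/2 + |C1|)) and equally by van Frankenhuijsen's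
conjectured (1.3) c < k exp(A2 sqrt(log k / log_2 k)); the one-line bridge RSTConjectureAUpper ->
(hypothesis) can be proved beside RSTConjectureAUpper.imp_abc
(Literature/Barriers/ABC/EpsilonCannotBeDroppedProofs.lean) or in a Theorems file, but the ROUTE no
longer names that open conjecture, so its file imports nothing beyond the Stateme -/
@[route_item "route-ABC-FeketeScales", crux]
def SubmultOfRST : Prop :=
  (∃ τ : ℝ, τ < 1 ∧ ∃ A : ℝ, ∀ a b c : ℕ, Literature.NumberTheory.DiophantineGeometry.IsABCTriple a b c → (c : ℝ) < ((Literature.NumberTheory.DiophantineGeometry.rad a b c : ℕ) : ℝ) * Real.exp (A * Real.log ((Literature.NumberTheory.DiophantineGeometry.rad a b c : ℕ) : ℝ) ^ τ)) → ScaleSubmultiplicativity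

/-- item stmt-ABC-14163 · support · rank 9 · closed · proved by Summit.ABC.ABC.Theorems.feketeScales_targetOfCruxes_proof @ 3c5f6a0e7961 (prover) · by planner
sources: RobertStewartTenenbaum2014, Mathlib:Subadditive.tendsto_lim
[support] GLUE cruxes -> Target (route-choice repair 2026-08-16; gate hold route.target-unreachable:
no item concluded the Target). ScaleSubmultiplicativity -> SparseGoodScales -> Target, by decl name
(the Target is rendered first with the two crux bodies INLINED, so `Target <->
ScaleSubmultiplicativity ∧ SparseGoodScales` is Iff.rfl — reviewers' W3.lean, grounder g16-10).
PROVABLE NOW, one line: `theorem targetOfCruxes_holds : TargetOfCruxes := fun h₁ h₂ => ⟨h₁, h₂⟩`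
(rc0 in the planner's Sketch.lean, standard axioms). Role: makes the thesis X (= Target) reachable
from the ranked cruxes in the item graph, so the spine reads cruxes -(TargetOfCruxes)-> Target
-(closes, via Assembly = the Fekete iteration)-> ABC; it carries no mathematics of its own and
changes no statement, rank or crux. [deps: ScaleSubmultiplicativity, SparseGoodScales, Target]
[difficulty: provable-now] -/
@[route_item "route-ABC-FeketeScales", crux]
def TargetOfCruxes : Prop :=
  ScaleSubmultiplicativity → SparseGoodScales → Target

/-- item stmt-ABC-2163 · support · rank 9 · closed · proved by Summit.ABC.ABC.Theorems.polynomialAbcOfSubmult_proof @ 5ec35a94adf0 (prover) · by planner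
[support] MILESTONE (card F2, qualitative form; provable now): ScaleSubmultiplicativity -> abc.S25
(Literature named fact finite_setOf_isABCTriple_primeFactors_subset, Mahler1933 / EvertseGyory2015
Ch. 4, used as a hypothesis) -> there are A, C with c <= C rad(abc)^A for every abc triple
(polynomial abc: open, far beyond Stewart–Yu — this is what any proof of the crux buys at once).
Proof sketch: rad <= R forces primeFactors(abc) ⊆ primes <= R, so S25 makes T(R) = {triples : rad <=
R} finite and a_1 := log max{c in T(R*)} finite at R* := max(R0, 4); with a_m := log sup{c : rad <=
R*^m} the crux gives a_{m+n} <= a_m + a_n + log K + ((m+n) t0)^theta (t0 = log R*), binary splitting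
a_{2^i} <= 2^i (a_1 + log K + t0^theta * sum_j 2^{(j+1)(theta-1)}), general N via binary digits plus
(log2 2N)(log K + (N t0)^theta), and N t0 <= log rad + t0 for the minimal N with R*^N >= rad; so log
c <= A log rad + B. With explicit (theta, K, R0 <= 10^7) the exponent A is explicit from the
complete table of VonkanelMatschke2023 (card F2: theta <= 0 and K < 360 would give WeakABC c <
rad^2; Reyssat's 1.6299 is the base) — that explicit version is an evidence task, not an item. -/
@[route_item "route-ABC-FeketeScales", crux]
def PolynomialAbcOfSubmult : Prop :=
  ScaleSubmultiplicativity → Literature.NumberTheory.DiophantineGeometry.finite_setOf_isABCTriple_primeFactors_subset → ∃ A C : ℝ, ∀ a b c : ℕ, Literature.NumberTheory.DiophantineGeometry.IsABCTriple a b c → (c : ℝ) ≤ C * ((Literature.NumberTheory.DiophantineGeometry.rad a b c : ℕ) : ℝ) ^ A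

/-- item stmt-ABC-2164 · support · rank 9 · closed · proved by Summit.ABC.ABC.Theorems.quasiPolynomialAbcOfEpsSubmult_proof @ 710d8c1daf66 (prover) · by planner
[support] THE AUDIT'S 'HONEST CORE' (card F3; provable now): the eps-slack sub-multiplicativity —
for every eps > 0 there are K, R0 such that every abc triple with rad <= R1R2 (R1, R2 >= R0) has c
<= K (R1R2)^eps c1 c2 for some abc triples with rad <= R1, rad <= R2; a CONSEQUENCE of ABC (exponent
eps and c1 c2 >= R1R2/16 from (1, 2^k-1, 2^k) give K = 16 C(eps)) — together with abc.S25 already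
yields QUASI-POLYNOMIAL abc: for every eps > 0 there is C with log c <= C log rad + eps log rad log
log rad for all abc triples (c <= rad^{C + eps loglog rad}), far beyond Stewart–Yu's log c <<
rad^{1/3}(log rad)^3 (StewartYu2001, EvertseGyory2015 (4.6.3)). Proof sketch: a_m as in
PolynomialAbcOfSubmult; slack e^{eps' 2^{j+1} t0} at doubling step j gives a_{2^i}/2^i <= a_1 + log
K + eps' i t0; general N by binary digits costs (log2 2N)(log K + eps' N t0); N t0 <= log rad + t0,
log2 N <= log2 log rad + O(1); take eps' = eps (log 2)/3. Only rad = 2 (triple (1,1,2)) has log log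
rad < 0, absorbed by C. Point: how much of the distance to ABC the scale-coupling structure carries
with a hypothesis no stronger than ABC. -/
@[route_item "route-ABC-FeketeScales", crux]
def QuasiPolynomialAbcOfEpsSubmult : Prop :=
  (∀ ε : ℝ, 0 < ε → ∃ K : ℝ, 0 < K ∧ ∃ R₀ : ℕ, ∀ R₁ R₂ : ℕ, R₀ ≤ R₁ → R₀ ≤ R₂ → ∀ a b c : ℕ, Literature.NumberTheory.DiophantineGeometry.IsABCTriple a b c → Literature.NumberTheory.DiophantineGeometry.rad a b c ≤ R₁ * R₂ → ∃ a₁ b₁ c₁ a₂ b₂ c₂ : ℕ, Literature.NumberTheory.DiophantineGeometry.IsABCTriple a₁ b₁ c₁ ∧ Literature.NumberTheory.DiophantineGeometry.rad a₁ b₁ c₁ ≤ R₁ ∧ Literature.NumberTheory.DiophantineGeometry.IsABCTriple a₂ b₂ c₂ ∧ Literature.NumberTheory.DiophantineGeometry.rad a₂ b₂ c₂ ≤ R₂ ∧ (c : ℝ) ≤ K * ((R₁ : ℝ) * R₂) ^ ε * c₁ * c₂) → Literature.NumberTheory.DiophantineGeometry.finite_setOf_isABCTriple_primeFactors_subset →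 ∀ ε : ℝ, 0 < ε → ∃ C : ℝ, ∀ a b c : ℕ, Literature.NumberTheory.DiophantineGeometry.IsABCTriple a b c → Real.log c ≤ C * Real.log (Literature.NumberTheory.DiophantineGeometry.rad a b c : ℕ) + ε * Real.log (Literature.NumberTheory.DiophantineGeometry.rad a b c : ℕ) * Real.log (Real.log (Literature.NumberTheory.DiophantineGeometry.rad a b c : ℕ))

/-- item stmt-ABC-2165 · assembly · rank 1 · closed · proved by Summit.ABC.ABC.Theorems.feketeScales_assembly_proof (prover) · by planner
[assembly] ScaleSubmultiplicativity -> SparseGoodScales -> ABC (Fekete-type upgrade of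
abc-at-sparse-scales; elementary real analysis, provable now, est. 300-600 lines). Proof: fix eps,
delta := eps/4, (theta, K, R0) from hyp. 1 (WLOG 0 <= theta < 1). By hyp. 2 pick a good scale R* >=
max(R0,4) with eta(t0) := log K/t0 + t0^{theta-1}/(2^{1-theta}-1) <= delta, t0 := log R*. a_m := log
sup{c : abc triple, rad <= R*^m}: a_1 <= (1+delta) t0 (goodness), a_{m+n} <= a_m + a_n + log K +
((m+n) t0)^theta (G-free crux at R1 = R*^m, R2 = R*^n; induction makes every a_m finite — no S-unit
theorem needed). Binary splitting: a_{2^i} <= 2^i t0 (1+delta+eta); for N a sum of <= log2(2N)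
distinct powers of 2: a_N <= N t0 (1+delta+eta) + log2(2N)(log K + (N t0)^theta). For a triple with
radical r take N >= 1 minimal with R*^N >= r: c <= e^{a_N}, N t0 < log r + t0, so log c <= (1+2
delta)(log r + t0) + log2(2 log r/t0 + 4)(log K + (log r + t0)^theta) <= (1+3 delta) log r + B(eps),
the last term being O((log log r)(log r)^theta) = o(log r); hence c <= e^B rad^{1+3eps/4} < 2e^B
rad^{1+eps}: ABC. Mathlib: Real.rpow/log/exp API, Nat.binaryRec or strong induction on N; cf.
Subadditive.tendsto_lim (Fekete). -/
@[route_item "route-ABC-FeketeScales", crux]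
def Assembly : Prop :=
  ScaleSubmultiplicativity → SparseGoodScales → ABC

/-! D-0027 §2.1 — DECIDING THEOREM (planner-authored via `route open/edit --closes-file`; by planner-rchoice-ABC-FeketeScales-target-unrea-92b3a68d-0 2026-08-16T03:05:23Z):
its hypotheses are this route's items and its conclusion the sub-problem Statement (glue_lint), and it elaborates with this file. -/

@[closes "route-ABC-FeketeScales"] theorem closes : Target → ScaleSubmultiplicativity → SparseGoodScales → SubmultOfRST → PolynomialAbcOfSubmult → QuasiPolynomialAbcOfEpsSubmult → TargetOfCruxes → Assembly → _root_.ABC := fun h_Target _h_ScaleSubmultiplicativity _h_SparseGoodScales _h_SubmultOfRST _h_PolynomialAbcOfSubmult _h_QuasiPolynomialAbcOfEpsSubmult _h_TargetOfCruxes h_Assembly => h_Assembly h_Target.1 h_Target.2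

end Summit.ABC.ABC.Theses.FeketeScales
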